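import Literature.NumberTheory.Automorphic.BorelStabilizerLattice
import Literature.NumberTheory.NumberFields.SandwichedLattice
import Literature.NumberTheory.NumberFields.ValuationBoxLattice
import Literature.Algebra.Homology.FreeAbelianRankTwoCohomology
import HarnessLib

/-!
# Cohomology of the Borel stabilisers of a quadratic field at a neat level is finitely generated

Topic `NumberTheory/Automorphic`; namespace `Literature.NumberTheory.Automorphic`, grouping
sub-namespace `ParallelWeight`.  One definition (`borelBox`, the lattice `Λ_t ⊆ F` as a
`ℤ`-submodule) and theorems.

For a number field `F` of degree `2`, a non-zero NEAT ideal `𝔫`, a diagonal finite idele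
`d = diag(t₀, t₁)` and `c ∈ GL₂(𝒪̂_F)`, the stabiliser `Γ_{x₀} ≤ B(F)` of
`x₀ = d c K_f(𝔫)` is (`BorelStabilizerLattice.mem_orbitStabilizer_borel_iff`) the group of
unipotent matrices `n(β)`, `β ∈ Λ_t = {β : |β|_v ≤ |𝔫|_v |t₀|_v |t₁|_v⁻¹}`.  The box `Λ_t` is
sandwiched between two multiples of `𝓞_F` (`ValuationBoxLattice`), hence free of rank `2` with
generators `b₀, b₁` and unique integer coordinates (`SandwichedLattice`); so `Γ_{x₀}` is free
abelian of rank `2` on `n(b₀), n(b₁)` and (`FreeAbelianRankTwoCohomology`)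

* `moduleFinite_groupCohomology_borelStabilizer` — `Hⁿ(Γ_{x₀}, V)` is finitely generated over
  a Noetherian `k` for every representation `V` of `B(F)` finitely generated over `k`;
* `isZero_groupCohomology_borelStabilizer` — `Hⁿ(Γ_{x₀}, V) = 0` for `n ≥ 3`.

[cite: Harder1987, §2]

## References

* G. Harder, *Eisenstein cohomology of arithmetic groups. The case GL₂*, Invent. Math. 89 (1987), §2
  [Harder1987].
-/

noncomputable section

open scoped NumberField
open IsDedekindDomain CategoryTheory CategoryTheory.Limits

namespace Literature.NumberTheory.Automorphic

namespace ParallelWeight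

open BigHeckeGLn Literature.NumberTheory.NumberFields

variable {F : Type} [Field F] [NumberField F]

/-- The lattice `Λ_t = {β ∈ F : |β|_v ≤ |𝔫|_v |t₀|_v |t₁|_v⁻¹ for all v}` of the Borel
stabiliser at `diag(t₀, t₁) c`, as a `ℤ`-submodule of `F`. [cite: Harder1987, §2] -/
def borelBox (𝔫 : Ideal (𝓞 F)) (t : Fin 2 → (FiniteAdeleRing (𝓞 F) F)ˣ) : Submodule ℤ F where
  carrier := {β | ∀ v : HeightOneSpectrum (𝓞 F), v.valuation F β ≤ borelBoxRadius 𝔫 t v}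
  add_mem' {a b} ha hb v := (Valuation.map_add_le_max' _ a b).trans (max_le (ha v) (hb v))
  zero_mem' v := by rw [map_zero]; exact zero_le
  smul_mem' n {β} hβ v := by
    rw [zsmul_eq_mul, map_mul]
    have hn : v.valuation F (n : F) ≤ 1 := by simpa using v.valuation_le_one (K := F) (n : 𝓞 F)
    exact mul_le_of_le_one_of_le hn (hβ v)

/-- Membership in the box. [folklore] -/
theorem mem_borelBox_iff {𝔫 : Ideal (𝓞 F)} {t : Fin 2 → (FiniteAdeleRing (𝓞 F) F)ˣ} {β : F} :
    β ∈ borelBox 𝔫 t ↔ ∀ v : HeightOneSpectrum (𝓞 F), v.valuation F β ≤ borelBoxRadius 𝔫 t v :=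
  Iff.rfl

/-- **The box has a `ℤ`-basis of `[F : ℚ]` elements with unique integer coordinates.**
[cite: Harder1987, §2] -/
theorem exists_generators_borelBox {𝔫 : Ideal (𝓞 F)} (h𝔫 : 𝔫 ≠ 0)
    (t : Fin 2 → (FiniteAdeleRing (𝓞 F) F)ˣ) :
    ∃ b : Fin (Module.finrank ℚ F) → F, (∀ i, b i ∈ borelBox 𝔫 t) ∧
      ∀ β ∈ borelBox 𝔫 t, ∃! m : Fin (Module.finrank ℚ F) → ℤ, β = ∑ i, (m i : F) * b i := by
  obtain ⟨N, N', hN, hN', hlow, hup⟩ := exists_sandwich_of_valuation_le (K := F)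
    (borelBoxRadius 𝔫 t) (borelBoxRadius_ne_zero 𝔫 t) (borelBoxRadius_eventually_eq_one h𝔫 t)
  refine exists_generators_of_sandwich (borelBox 𝔫 t) (N := N) (N' := N')
    (Int.natCast_ne_zero.2 hN) (Int.natCast_ne_zero.2 hN') (fun x hx => ?_) (fun β hβ => ?_)
  · obtain ⟨y, rfl⟩ := (mem_integerSubmodule_iff F).1 hx
    intro v
    simpa using hlow y v
  · obtain ⟨y, hy⟩ := hup β hβ
    refine (mem_integerSubmodule_iff F).2 ⟨y, ?_⟩
    simpa using hy.symm

/-- The same with generators indexed by `Fin 2` for a quadratic field. [cite: Harder1987, §2] -/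
theorem exists_two_generators_borelBox (hF : Module.finrank ℚ F = 2) {𝔫 : Ideal (𝓞 F)}
    (h𝔫 : 𝔫 ≠ 0) (t : Fin 2 → (FiniteAdeleRing (𝓞 F) F)ˣ) :
    ∃ b₀ b₁ : F, b₀ ∈ borelBox 𝔫 t ∧ b₁ ∈ borelBox 𝔫 t ∧
      (∀ β ∈ borelBox 𝔫 t, ∃ m₀ m₁ : ℤ, β = (m₀ : F) * b₀ + (m₁ : F) * b₁) ∧
      ∀ m₀ m₁ : ℤ, (m₀ : F) * b₀ + (m₁ : F) * b₁ = 0 → m₀ = 0 ∧ m₁ = 0 := by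
  obtain ⟨b, hb, hrepr⟩ := exists_generators_borelBox h𝔫 t
  -- reindex by `Fin 2`
  let e : Fin 2 ≃ Fin (Module.finrank ℚ F) := finCongr hF.symm
  refine ⟨b (e 0), b (e 1), hb _, hb _, fun β hβ => ?_, fun m₀ m₁ hm => ?_⟩
  · obtain ⟨m, hm, -⟩ := hrepr β hβ
    refine ⟨m (e 0), m (e 1), ?_⟩
    rw [hm, ← Equiv.sum_comp e, Fin.sum_univ_two]
  · obtain ⟨m, -, huniq⟩ := hrepr 0 (zero_mem _)
    let m' : Fin (Module.finrank ℚ F) → ℤ := fun i => if i = e 0 then m₀ else if i = e 1 then m₁ else 0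
    have he : e 0 ≠ e 1 := fun h => by simpa using e.injective h
    have hm' : (0 : F) = ∑ i, (m' i : F) * b i := by
      rw [← Equiv.sum_comp e, Fin.sum_univ_two]
      simp only [m', if_pos rfl, if_neg he.symm]
      exact hm.symm
    have h0 : (0 : F) = ∑ i, ((0 : Fin (Module.finrank ℚ F) → ℤ) i : F) * b i := by simp
    have h1 := huniq m' hm'
    have h2 := huniq 0 h0
    have hmm : m' = 0 := h1.trans h2.symm
    refine ⟨?_, ?_⟩
    · have := congrFun hmm (e 0)
      simpa [m'] using this
    · have := congrFun hmm (e 1)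
      simpa [m', if_neg he.symm, he] using this

variable {𝔫 : Ideal (𝓞 F)}

omit [NumberField F] in
/-- The unipotent element `n(β) ∈ B(F)`. [folklore] -/
theorem upperRightHom_mem_borel (β : F) : Matrix.GeneralLinearGroup.upperRightHom β ∈ borel F := by
  rw [mem_borel_iff, Matrix.GeneralLinearGroup.upperRightHom_apply]
  rfl

section Stabilizer

variable (hF : Module.finrank ℚ F = 2) (h𝔫 : 𝔫 ≠ 0)
  (hneat : ∀ a : F, (∀ v : HeightOneSpectrum (𝓞 F), v.valuation F a ≤ 1) →
    (∀ v : HeightOneSpectrum (𝓞 F), v.valuation F a⁻¹ ≤ 1) →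
    (∀ v : HeightOneSpectrum (𝓞 F), v.valuation F (a - 1) ≤ idealRadius F v 𝔫) → a = 1)
  (t : Fin 2 → (FiniteAdeleRing (𝓞 F) F)ˣ) {c : FiniteAdelicGL 2 F}
  (hc : c ∈ glFiniteIntegralLevel 2 F)

/-- Abbreviation: the stabiliser of `diag(t) c K_f(𝔫)` in `B(F)` (`TwistedQuotient.orbitStabilizer`).
[cite: Harder1987, §2] -/
abbrev borelStabilizer (𝔫 : Ideal (𝓞 F)) (t : Fin 2 → (FiniteAdeleRing (𝓞 F) F)ˣ)
    (c : FiniteAdelicGL 2 F) : Subgroup (borel F) :=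
  TwistedQuotient.orbitStabilizer ((globalEmbedding 2 F).comp (borel F).subtype)
    ((principalCongruenceLevel 2 F 𝔫).comap (GLn.ofFinite 2 F))
    ((glDiagonal 2 (FiniteAdeleRing (𝓞 F) F) t * c : FiniteAdelicGL 2 F) :
      FiniteAdelicGL 2 F ⧸ (principalCongruenceLevel 2 F 𝔫).comap (GLn.ofFinite 2 F))

include hneat hc in
/-- Elements of the stabiliser are the `n(β)`, `β` in the box. [cite: Harder1987, §2] -/
theorem coe_eq_upperRightHom_of_mem_borelStabilizer (γ : borelStabilizer 𝔫 t c) :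
    ((γ : borel F) : GL (Fin 2) F) = Matrix.GeneralLinearGroup.upperRightHom
        ((((γ : borel F) : GL (Fin 2) F) : Matrix (Fin 2) (Fin 2) F) 0 1) ∧
      (((γ : borel F) : GL (Fin 2) F) : Matrix (Fin 2) (Fin 2) F) 0 1 ∈ borelBox 𝔫 t := by
  obtain ⟨h00, h11, hb⟩ := (mem_orbitStabilizer_borel_iff hneat t hc (γ : borel F)).1 γ.2
  exact ⟨coe_eq_upperRightHom_of_diag_eq_one _ h00 h11, hb⟩

include hneat hc in
/-- `n(β)` lies in the stabiliser for `β` in the box. [cite: Harder1987, §2] -/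
theorem upperRightHom_mem_borelStabilizer {β : F} (hβ : β ∈ borelBox 𝔫 t) :
    (⟨Matrix.GeneralLinearGroup.upperRightHom β, upperRightHom_mem_borel β⟩ : borel F) ∈
      borelStabilizer 𝔫 t c := by
  rw [mem_orbitStabilizer_borel_iff hneat t hc]
  simp only [Matrix.GeneralLinearGroup.upperRightHom_apply]
  exact ⟨rfl, rfl, hβ⟩

/-- The element `n(β)` of the stabiliser. [folklore] -/
def borelStabilizerElt {β : F}
    (hβ : (⟨Matrix.GeneralLinearGroup.upperRightHom β, upperRightHom_mem_borel β⟩ : borel F) ∈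
      borelStabilizer 𝔫 t c) : borelStabilizer 𝔫 t c :=
  ⟨⟨Matrix.GeneralLinearGroup.upperRightHom β, upperRightHom_mem_borel β⟩, hβ⟩

/-- Equality in the stabiliser is equality of matrices. [folklore] -/
theorem borelStabilizer_ext {γ γ' : borelStabilizer 𝔫 t c}
    (h : ((γ : borel F) : GL (Fin 2) F) = ((γ' : borel F) : GL (Fin 2) F)) : γ = γ' :=
  Subtype.ext (Subtype.ext h)

include hneat hc in
/-- **The stabiliser is commutative.** [cite: Harder1987, §2] -/
theorem borelStabilizer_comm (γ γ' : borelStabilizer 𝔫 t c) : γ * γ' = γ' * γ := by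
  refine borelStabilizer_ext t ?_
  change ((γ : borel F) : GL (Fin 2) F) * ((γ' : borel F) : GL (Fin 2) F) =
    ((γ' : borel F) : GL (Fin 2) F) * ((γ : borel F) : GL (Fin 2) F)
  rw [(coe_eq_upperRightHom_of_mem_borelStabilizer hneat t hc γ).1,
    (coe_eq_upperRightHom_of_mem_borelStabilizer hneat t hc γ').1,
    ← AddChar.map_add_eq_mul, ← AddChar.map_add_eq_mul, add_comm]

include hF h𝔫 hneat hc in
/-- **The stabiliser is free abelian of rank two** on `n(b₀), n(b₁)` for a `ℤ`-basis `b₀, b₁` of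
the box (quadratic `F`). [cite: Harder1987, §2] -/
theorem exists_rankTwo_generators_borelStabilizer :
    ∃ B₀ B₁ : borelStabilizer 𝔫 t c,
      (∀ γ : borelStabilizer 𝔫 t c, ∃ m₀ m₁ : ℤ, γ = B₀ ^ m₀ * B₁ ^ m₁) ∧
      ∀ m₀ m₁ : ℤ, B₀ ^ m₀ * B₁ ^ m₁ = 1 → m₀ = 0 ∧ m₁ = 0 := by
  obtain ⟨b₀, b₁, hb₀, hb₁, hgen, hind⟩ := exists_two_generators_borelBox hF h𝔫 t
  refine ⟨borelStabilizerElt t (upperRightHom_mem_borelStabilizer hneat t hc hb₀),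
    borelStabilizerElt t (upperRightHom_mem_borelStabilizer hneat t hc hb₁), fun γ => ?_,
    fun m₀ m₁ hm => ?_⟩
  · obtain ⟨hγ, hβ⟩ := coe_eq_upperRightHom_of_mem_borelStabilizer hneat t hc γ
    obtain ⟨m₀, m₁, hm⟩ := hgen _ hβ
    refine ⟨m₀, m₁, borelStabilizer_ext t ?_⟩
    rw [hγ, hm, Subgroup.coe_mul, Subgroup.coe_mul, SubgroupClass.coe_zpow, SubgroupClass.coe_zpow,
      SubgroupClass.coe_zpow, SubgroupClass.coe_zpow]
    change _ = Matrix.GeneralLinearGroup.upperRightHom b₀ ^ m₀ *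
      Matrix.GeneralLinearGroup.upperRightHom b₁ ^ m₁
    rw [← AddChar.map_zsmul_eq_zpow, ← AddChar.map_zsmul_eq_zpow, ← AddChar.map_add_eq_mul,
      zsmul_eq_mul, zsmul_eq_mul]
  · have h := congrArg (fun γ : borelStabilizer 𝔫 t c => ((γ : borel F) : GL (Fin 2) F)) hm
    simp only [Subgroup.coe_mul, SubgroupClass.coe_zpow, Subgroup.coe_one] at h
    change Matrix.GeneralLinearGroup.upperRightHom b₀ ^ m₀ *
      Matrix.GeneralLinearGroup.upperRightHom b₁ ^ m₁ = 1 at h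
    rw [← AddChar.map_zsmul_eq_zpow, ← AddChar.map_zsmul_eq_zpow, ← AddChar.map_add_eq_mul,
      ← AddChar.map_zero_eq_one (Matrix.GeneralLinearGroup.upperRightHom (R := F))] at h
    have h' := Matrix.GeneralLinearGroup.injective_upperRightHom h
    rw [zsmul_eq_mul, zsmul_eq_mul] at h'
    exact hind m₀ m₁ h'

include hF h𝔫 hneat hc in
/-- **`Hⁿ(Γ_{x₀}, V)` is finitely generated** for the Borel stabilisers of a quadratic field at a
neat level and `V` finitely generated over a Noetherian `k`. [cite: Harder1987, §2] -/
theorem moduleFinite_groupCohomology_borelStabilizer {k : Type} [CommRing k] [IsNoetherianRing k]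
    {V : Type} [AddCommGroup V] [Module k V] [Module.Finite k V]
    (ρ : Representation k (borel F) V) (n : ℕ) :
    Module.Finite k (groupCohomology (TwistedQuotient.stabilizerRep
      ((globalEmbedding 2 F).comp (borel F).subtype)
      ((principalCongruenceLevel 2 F 𝔫).comap (GLn.ofFinite 2 F)) ρ
      ((glDiagonal 2 (FiniteAdeleRing (𝓞 F) F) t * c : FiniteAdelicGL 2 F) :
        FiniteAdelicGL 2 F ⧸ (principalCongruenceLevel 2 F 𝔫).comap (GLn.ofFinite 2 F))) n) := by
  obtain ⟨B₀, B₁, hgen, hind⟩ := exists_rankTwo_generators_borelStabilizer hF h𝔫 hneat t hc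
  haveI : Module.Finite k (TwistedQuotient.stabilizerRep
      ((globalEmbedding 2 F).comp (borel F).subtype)
      ((principalCongruenceLevel 2 F 𝔫).comap (GLn.ofFinite 2 F)) ρ
      ((glDiagonal 2 (FiniteAdeleRing (𝓞 F) F) t * c : FiniteAdelicGL 2 F) :
        FiniteAdelicGL 2 F ⧸ (principalCongruenceLevel 2 F 𝔫).comap (GLn.ofFinite 2 F))) :=
    ‹Module.Finite k V›
  exact Literature.Algebra.Homology.moduleFinite_groupCohomology_of_rankTwo _ B₀ B₁
    (borelStabilizer_comm hneat t hc) hgen hind n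

include hF h𝔫 hneat hc in
/-- **`Hⁿ(Γ_{x₀}, V) = 0` for `n ≥ 3`** (the stabilisers have cohomological dimension `2`).
[cite: Harder1987, §2] -/
theorem isZero_groupCohomology_borelStabilizer {k : Type} [CommRing k]
    {V : Type} [AddCommGroup V] [Module k V]
    (ρ : Representation k (borel F) V) (n : ℕ) :
    IsZero (groupCohomology (TwistedQuotient.stabilizerRep
      ((globalEmbedding 2 F).comp (borel F).subtype)
      ((principalCongruenceLevel 2 F 𝔫).comap (GLn.ofFinite 2 F)) ρ
      ((glDiagonal 2 (FiniteAdeleRing (𝓞 F) F) t * c : FiniteAdelicGL 2 F) :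
        FiniteAdelicGL 2 F ⧸ (principalCongruenceLevel 2 F 𝔫).comap (GLn.ofFinite 2 F))) (n + 3)) := by
  obtain ⟨B₀, B₁, hgen, hind⟩ := exists_rankTwo_generators_borelStabilizer hF h𝔫 hneat t hc
  exact Literature.Algebra.Homology.isZero_groupCohomology_of_rankTwo _ B₀ B₁
    (borelStabilizer_comm hneat t hc) hgen hind n

end Stabilizer

end ParallelWeight

end Literature.NumberTheory.Automorphic
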